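import Summits.HubbardSuperconductivity.HubbardSuperconductivity.Theorems.InfiniteVolumeFirstNoInfraredPileUpNoSliding
import Summits.HubbardSuperconductivity.HubbardSuperconductivity.Theorems.FunctionFieldCertificateWindowInfraredBoundFreeCalibration

/-!
# Crux `NoInfraredPileUp` (stmt-HubbardSuperconductivity-18534, route `InfiniteVolumeFirst`) —
# mass transfer II: TIGHTNESS ⇔ CONSERVATION OF CONDENSATE MASS IN EVERY TORUS LIMIT

Notation as in `InfiniteVolumeFirstNoInfraredPileUpMassTransferLemmas.lean` (`S_L`, `n_L`, `T_ε(L)`,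
`C_L`, `atom(C)`). The route's thesis asserts informally that "the condensate atom is continuous
along the limit iff no macroscopic `d`-wave pair weight piles up at momenta `0 < |q| ≤ ε → 0`".
This file makes that sentence a theorem, per family and at the level of the crux:

* `exists_massGain_of_not_tight` — if the windows of `ψ` are NOT tight, some pointwise-convergent
  subsequence of even sides GAINS mass: `n_{L_j} → n₀` while `R⁻⁴ Σ_{x,y∈[0,R)²} C(x−y) ≥ n₀ + η` at
  every block scale `R ≥ 1`, so `atom(C) ≥ n₀ + η` (bad sides for the windows `1/(k+1)`,
  Bolzano–Weierstrass for `n_L ∈ [0, C_d²]`, diagonal compactness for `C_L`, and the windowed Fejér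
  lower bound `boxAvg_ge_window` in the limit at fixed `R`) — this sharpens the standing disprover's
  `pileUpForcesLimitAtom` (`atom ≥ η/16`) to `atom ≥ lim_j n_{L_j} + η`;
* `stub_tight_iff_lroSeqTendstoAtom` (registered stub) — for `ψ` normalised at the even sides:
  tight windows ⇔ (`n_{L_j} → atom(C)` along every pointwise-convergent subsequence of even sides);
* `noInfraredPileUp_iff_condensateMassConserved` — the crux itself is EQUIVALENT to: at every
  doping, for all sufficiently weak couplings, every admissible ground-state family conserves
  condensate mass in every infinite-volume (torus-limit) state. So a refutation of the crux is
  exactly a weak-coupling ground-state family one of whose infinite-volume limits carries MORE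
  `d_{x²−y²}` ODLRO than the limit of the torus order densities it comes from (generalised
  condensation feeding the atom), and a proof is exactly the exclusion of such mass gain.

* `summitAt_iff_atomPos_and_noSliding` — at every FIXED `(U, δ)`: (every admissible ground-state
  family has `d`-wave pair LRO) ⇔ (every torus-limit of every admissible family has a positive atom)
  ∧ (every admissible family satisfies Sub₁ "no sliding condensate" of
  `InfiniteVolumeFirstNoInfraredPileUpNoSliding.lean`): with Sub₁ in place of `NoInfraredPileUp` the
  route is a LOSSLESS decomposition of the summit's conclusion, coupling by coupling.

* `noInfraredPileUp_conclusion_at_zero_coupling` — at the excluded endpoint `U = 0` the crux's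
  conclusion holds for EVERY free ground-state family (flat metallic law `T_ε ≤ 113 ε² L²` of
  `windowInfraredBound_free_allGroundStates`): any pile-up must be interaction-driven.

Sources: T. Kennedy, E. H. Lieb, B. S. Shastry, PRL **61** (1988) 2582; J. Fröhlich, B. Simon,
T. Spencer, CMP **50** (1976) 79, §3; S. Friedli, Y. Velenik (2017) §3.7.2, §10.4; M. Girardeau,
Phys. Fluids **5** (1962) 1468 and M. van den Berg, J. T. Lewis, J. V. Pulé, Helv. Phys. Acta **59**
(1986) 1271 (generalised condensation = condensate mass at `0 < |q| → 0`); P. Billingsley,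
*Convergence of Probability Measures* (1999) §1.2. Folklore finite-dimensional statements; no
definition and no named fact is introduced.
-/

noncomputable section

-- the mandated namespace `Summit.<Summit>.<Problem>.Theorems` repeats `HubbardSuperconductivity`
-- (single-problem summit, D-0017), which the `dupNamespace` linter flags on every declaration
set_option linter.dupNamespace false

namespace Summit.HubbardSuperconductivity.HubbardSuperconductivity.Theorems.NoInfraredPileUp

open Literature.MathematicalPhysics.QuantumLattice Literature.Probability.LatticeModels Matrix Finset
  Filter
open Summit.HubbardSuperconductivity.HubbardSuperconductivity.Theorems
open scoped ComplexConjugate ComplexOrder Topology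

/-! ### Non-tight windows: some limit gains condensate mass -/

/-- **Pile-up ⇒ gain of condensate mass in some limit.** Let `ψ_L` be normalised at the even sides
and let its windows be NOT tight: `∃ η > 0 ∀ ε > 0 ∀ L₀ ∃ even L ≥ L₀: Σ_{m≠0,|q_m|≤ε} S_L(m) > ηL²`.
Then for this `η` there are a strictly increasing sequence of even sides `L_j`, a pointwise limit `C`
of the translation-averaged pair correlations along it and a limit `n₀` of the torus condensate
densities `|Λ_{L_j}|⁻² Σ G_{L_j}` along it such that EVERY block average of the limit exceeds the
limiting condensate density by `η`: `n₀ + η ≤ R⁻⁴ Σ_{x,y∈[0,R)²} C(x−y)` for all `R ≥ 1` (so the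
atom of `C` is `≥ n₀ + η`). Bad sides for the windows `1/(k+1)`; Bolzano–Weierstrass for the
densities in `[0, C_d²]`; diagonal compactness in `[-C_d², C_d²]^{ℤ²}`; the windowed Fejér lower
bound `boxAvg_ge_window` passes to the limit at fixed `R`. Sharpens `pileUpForcesLimitAtom`.
Kennedy–Lieb–Shastry, PRL 61 (1988) 2582; Girardeau, Phys. Fluids 5 (1962) 1468;
van den Berg–Lewis–Pulé, Helv. Phys. Acta 59 (1986) 1271. [folklore] -/
theorem exists_massGain_of_not_tight (ψ : ∀ L, Fock (Orb (FermionTorus 2 L)))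
    (hnorm : ∀ L, Even L → star (ψ L) ⬝ᵥ ψ L = 1)
    (hnt : ¬ (∀ η : ℝ, 0 < η → ∃ ε : ℝ, 0 < ε ∧ ∃ L₀ : ℕ, ∀ (L : ℕ) [NeZero L], Even L → L₀ ≤ L →
      (∑ m : Fin 2 → ZMod L, if m ≠ 0 ∧ momentumNormSq L m ≤ ε ^ 2 then
          pairStructureFactor dWaveFormFactor L (ψ L) m else 0) ≤ η * (L : ℝ) ^ 2)) :
    ∃ η : ℝ, 0 < η ∧ ∃ (Ls : ℕ → ℕ) (C : Site 2 → ℝ) (n₀ : ℝ), StrictMono Ls ∧ (∀ j, Even (Ls j)) ∧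
      (∀ x : Site 2, Tendsto (fun j : ℕ => (∑ y ∈ halfOpenBox 2 (Ls j),
          torusPullback (pairFieldCorr dWaveFormFactor ψ) (Ls j) (x + y) y) / ((Ls j : ℕ) : ℝ) ^ 2)
        atTop (𝓝 (C x))) ∧
      Tendsto (fun j : ℕ => (∑ x ∈ halfOpenBox 2 (Ls j), ∑ y ∈ halfOpenBox 2 (Ls j),
          torusPullback (pairFieldCorr dWaveFormFactor ψ) (Ls j) x y) /
            ((halfOpenBox 2 (Ls j)).card : ℝ) ^ 2) atTop (𝓝 n₀) ∧
      ∀ R : ℕ, 0 < R →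
        n₀ + η ≤ (∑ x ∈ halfOpenBox 2 R, ∑ y ∈ halfOpenBox 2 R, C (x - y)) / ((R : ℕ) : ℝ) ^ 4 := by
  classical
  push Not at hnt
  obtain ⟨η, hη, hbad⟩ := hnt
  refine ⟨η, hη, ?_⟩
  -- the constant `C_d²`
  obtain ⟨B, hB⟩ : ∃ B : ℝ, B = (∑ e ∈ insert (0 : Site 2) unitSteps,
      ‖((dWaveFormFactor e / Real.sqrt 2 : ℝ) : ℂ)‖ * 2) ^ 2 := ⟨_, rfl⟩
  have hB0 : 0 ≤ B := by rw [hB]; positivity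
  -- the long-range-order sequence and the translation-averaged pair correlations
  obtain ⟨u, hu⟩ : ∃ u : ℕ → ℝ, ∀ L, u L = (∑ x ∈ halfOpenBox 2 L, ∑ y ∈ halfOpenBox 2 L,
      torusPullback (pairFieldCorr dWaveFormFactor ψ) L x y) / ((halfOpenBox 2 L).card : ℝ) ^ 2 :=
    ⟨_, fun _ => rfl⟩
  obtain ⟨Cavg, hCavg⟩ : ∃ Cavg : ℕ → Site 2 → ℝ, ∀ L x, Cavg L x =
      (∑ y ∈ halfOpenBox 2 L, torusPullback (pairFieldCorr dWaveFormFactor ψ) L (x + y) y) /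
        ((L : ℕ) : ℝ) ^ 2 := ⟨_, fun _ _ => rfl⟩
  -- the window tail at side `n + 1` and radius `ε`
  obtain ⟨T, hT⟩ : ∃ T : ℕ → ℝ → ℝ, ∀ n ε, T n ε = ∑ m : TorusSite 2 (n + 1),
      if m ≠ 0 ∧ momentumNormSq (n + 1) m ≤ ε ^ 2 then
        pairStructureFactor dWaveFormFactor (n + 1) (ψ (n + 1)) m else 0 := ⟨_, fun _ _ => rfl⟩
  -- Step 1: bad sides `φ₀ k + 1` for the windows `ε_k = 1/(k+1)`
  have hkpos : ∀ k : ℕ, (0 : ℝ) < 1 / ((k : ℝ) + 1) := fun k => by positivity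
  have hfreq : ∀ k : ℕ, ∃ᶠ n in atTop, Even (n + 1) ∧
      η * ((n + 1 : ℕ) : ℝ) ^ 2 < T n (1 / ((k : ℝ) + 1)) := by
    intro k
    rw [frequently_atTop]
    intro L₀
    obtain ⟨L, inst, hLe, hLL, hLT⟩ := hbad (1 / ((k : ℝ) + 1)) (hkpos k) (L₀ + 1)
    obtain ⟨n, rfl⟩ : ∃ n, L = n + 1 := ⟨L - 1, by have := NeZero.ne L; omega⟩
    refine ⟨n, by omega, hLe, ?_⟩
    rw [hT]
    convert hLT using 1
  obtain ⟨φ₀, hφ₀, hφ₀P⟩ := extraction_forall_of_frequently hfreq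
  -- Step 2: a subsequence along which the condensate densities converge (Bolzano–Weierstrass)
  have hu0 : ∀ L, 0 ≤ u L := fun L => by rw [hu]; exact tightnessExchange_lroSeq_nonneg ψ _
  have huB : ∀ k, u (φ₀ k + 1) ≤ B := fun k => by
    rw [hu, hB]; exact tightnessExchange_lroSeq_le ψ _ (hnorm _ (hφ₀P k).1)
  obtain ⟨n₀, -, φ₁, hφ₁, hn₀⟩ := tendsto_subseq_of_bounded (Metric.isBounded_Icc (0 : ℝ) B)
    (x := fun k => u (φ₀ k + 1)) (fun k => ⟨hu0 _, huB k⟩)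
  -- Step 3: a further subsequence along which `C_L` converges pointwise (diagonal argument)
  obtain ⟨K, hK⟩ : ∃ K : Set (Site 2 → ℝ), K = Set.pi Set.univ fun _ => Set.Icc (-B) B :=
    ⟨_, rfl⟩
  have hKc : IsCompact K := hK ▸ isCompact_univ_pi fun _ => isCompact_Icc
  have hCB : ∀ k x, |Cavg (φ₀ k + 1) x| ≤ B := fun k x => by
    rw [hCavg, hB]; exact tightnessExchange_abs_corrAvg_le ψ _ (hnorm _ (hφ₀P k).1) x
  have hmem : ∀ i, (fun x => Cavg (φ₀ (φ₁ i) + 1) x) ∈ K := fun i =>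
    hK ▸ Set.mem_univ_pi.2 fun x => abs_le.1 (hCB _ x)
  obtain ⟨C, -, φ₂, hφ₂, hconv⟩ := hKc.tendsto_subseq hmem
  -- the final subsequence of sides
  obtain ⟨ι, hι⟩ : ∃ ι : ℕ → ℕ, ∀ j, ι j = φ₁ (φ₂ j) := ⟨_, fun _ => rfl⟩
  have hι_mono : StrictMono ι := fun i j hij => by rw [hι, hι]; exact hφ₁ (hφ₂ hij)
  obtain ⟨Ls, hLs⟩ : ∃ Ls : ℕ → ℕ, ∀ j, Ls j = φ₀ (ι j) + 1 := ⟨_, fun _ => rfl⟩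
  have hLs_mono : StrictMono Ls := fun i j hij => by
    rw [hLs, hLs]
    exact Nat.succ_lt_succ (hφ₀ (hι_mono hij))
  have hLs_even : ∀ j, Even (Ls j) := fun j => hLs j ▸ (hφ₀P (ι j)).1
  have hLs_conv : ∀ x : Site 2, Tendsto (fun j => Cavg (Ls j) x) atTop (𝓝 (C x)) := fun x =>
    (tendsto_pi_nhds.1 hconv x).congr fun j => by simp only [Function.comp_apply, hLs, hι]
  have hu_conv : Tendsto (fun j => u (Ls j)) atTop (𝓝 n₀) :=
    (hn₀.comp hφ₂.tendsto_atTop).congr fun j => by simp only [Function.comp_apply, hLs, hι]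
  refine ⟨Ls, C, n₀, hLs_mono, hLs_even, fun x => by simpa only [hCavg] using hLs_conv x,
    by simpa only [hu] using hu_conv, ?_⟩
  -- Step 4: at every block scale `R ≥ 1` the block average of `C` is at least `n₀ + η`
  intro R hR
  -- the windows along the final subsequence shrink to `0`
  obtain ⟨εs, hεs⟩ : ∃ εs : ℕ → ℝ, ∀ j, εs j = 1 / ((ι j : ℝ) + 1) := ⟨_, fun _ => rfl⟩
  have hεs_pos : ∀ j, 0 < εs j := fun j => by rw [hεs]; exact hkpos _
  have hεs_tend : Tendsto εs atTop (𝓝 0) := by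
    have h := (tendsto_one_div_add_atTop_nhds_zero_nat (𝕜 := ℝ)).comp hι_mono.tendsto_atTop
    exact h.congr fun j => by simp only [Function.comp_apply, hεs]
  -- both sides of the windowed Fejér lower bound converge
  have h4 : Tendsto (fun j => 4 * εs j * (R : ℝ)) atTop (𝓝 (4 * 0 * (R : ℝ))) :=
    (hεs_tend.const_mul 4).mul_const _
  have hlhs : Tendsto (fun j => (1 - 4 * εs j * R) * (u (Ls j) + η)) atTop
      (𝓝 ((1 - 4 * 0 * R) * (n₀ + η))) :=
    (h4.const_sub 1).mul (hu_conv.add_const η)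
  rw [mul_zero, zero_mul, sub_zero, one_mul] at hlhs
  have hrhs : Tendsto (fun j => (∑ x ∈ halfOpenBox 2 R, ∑ y ∈ halfOpenBox 2 R,
      Cavg (Ls j) (x - y)) / ((R : ℕ) : ℝ) ^ 4) atTop
      (𝓝 ((∑ x ∈ halfOpenBox 2 R, ∑ y ∈ halfOpenBox 2 R, C (x - y)) / ((R : ℕ) : ℝ) ^ 4)) :=
    (tendsto_finsetSum _ fun x _ => tendsto_finsetSum _ fun y _ => hLs_conv (x - y)).div_const _
  refine le_of_tendsto_of_tendsto hlhs hrhs ?_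
  -- eventually `4 ε_j R ≤ 1`, and then the finite-side inequality holds
  have hsmall : ∀ᶠ j in atTop, 4 * εs j * R ≤ 1 := by
    rw [mul_zero, zero_mul] at h4
    exact h4.eventually_le_const one_pos
  filter_upwards [hsmall] with j hj
  have hbadj := (hφ₀P (ι j)).2
  rw [← hεs] at hbadj
  -- the finite-side windowed Fejér lower bound at side `Ls j = φ₀ (ι j) + 1`
  have hfe := boxAvg_ge_window ψ (φ₀ (ι j)) R hR (hεs_pos j).le
  rw [← hu, ← hT] at hfe
  have hLpos : (0 : ℝ) < ((φ₀ (ι j) + 1 : ℕ) : ℝ) ^ 2 := by positivity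
  have hTge : η ≤ T (φ₀ (ι j)) (εs j) / ((φ₀ (ι j) + 1 : ℕ) : ℝ) ^ 2 := by
    rw [le_div_iff₀ hLpos]; exact hbadj.le
  have hfac : 0 ≤ 1 - 4 * εs j * R := by linarith
  simp only [hLs, hCavg]
  calc (1 - 4 * εs j * R) * (u (φ₀ (ι j) + 1) + η)
      ≤ (1 - 4 * εs j * R) * (u (φ₀ (ι j) + 1) +
          T (φ₀ (ι j)) (εs j) / ((φ₀ (ι j) + 1 : ℕ) : ℝ) ^ 2) :=
        mul_le_mul_of_nonneg_left (by linarith) hfac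
    _ ≤ _ := hfe

/-! ### The characterisation -/

/-- **MASS-TRANSFER CHARACTERISATION OF TIGHTNESS** (registered stub `stub_tight_iff_lroSeqTendstoAtom`
of crux stmt-HubbardSuperconductivity-18534). For any family `ψ_L` of torus Fock vectors normalised
at the even sides, the following are equivalent:
(i) the small-momentum windows of the `d`-wave pair structure factor are tight
(`∀ η > 0 ∃ ε > 0, L₀ ∀ even L ≥ L₀: Σ_{m≠0,|q_m|≤ε} S_L(m) ≤ ηL²` — the conclusion of `NoInfraredPileUp`
for `ψ`);
(ii) along every strictly increasing sequence of even sides on which the translation-averaged pair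
correlations `C_L(x) = L⁻² Σ_y G_L(x+y,y)` converge pointwise on `ℤ²` to some `C`, the torus condensate
densities `|Λ_L|⁻² Σ_{x,y∈Λ_L} G_L(x,y)` converge to the Bochner atom
`liminf_R R⁻⁴ Σ_{x,y∈[0,R)²} C(x−y)` of the limit (no `d`-wave condensate mass is gained or lost in
any infinite-volume limit). This is the sentence of the route's thesis "the condensate atom is
continuous along the limit iff no macroscopic pair weight piles up at momenta `0 < |q| ≤ ε → 0`" made
a theorem. Kennedy–Lieb–Shastry, PRL 61 (1988) 2582; Friedli–Velenik (2017) §3.7.2, §10.4;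
Girardeau, Phys. Fluids 5 (1962) 1468; Billingsley (1999) §1.2. [folklore] -/
theorem stub_tight_iff_lroSeqTendstoAtom :
    ∀ (ψ : ∀ L, Fock (Orb (FermionTorus 2 L))), (∀ L, Even L → star (ψ L) ⬝ᵥ ψ L = 1) →
      ((∀ η : ℝ, 0 < η → ∃ ε : ℝ, 0 < ε ∧ ∃ L₀ : ℕ, ∀ (L : ℕ) [NeZero L], Even L → L₀ ≤ L →
          (∑ m : Fin 2 → ZMod L, if m ≠ 0 ∧ momentumNormSq L m ≤ ε ^ 2 then
              pairStructureFactor dWaveFormFactor L (ψ L) m else 0) ≤ η * (L : ℝ) ^ 2) ↔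
        ∀ (Ls : ℕ → ℕ) (C : Site 2 → ℝ), StrictMono Ls → (∀ j, Even (Ls j)) →
          (∀ x : Site 2, Tendsto (fun j : ℕ => (∑ y ∈ halfOpenBox 2 (Ls j),
              torusPullback (pairFieldCorr dWaveFormFactor ψ) (Ls j) (x + y) y) /
                ((Ls j : ℕ) : ℝ) ^ 2) atTop (𝓝 (C x))) →
            Tendsto (fun j : ℕ => (∑ x ∈ halfOpenBox 2 (Ls j), ∑ y ∈ halfOpenBox 2 (Ls j),
                torusPullback (pairFieldCorr dWaveFormFactor ψ) (Ls j) x y) /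
                  ((halfOpenBox 2 (Ls j)).card : ℝ) ^ 2) atTop
              (𝓝 (liminf (fun R : ℕ => (∑ x ∈ halfOpenBox 2 R, ∑ y ∈ halfOpenBox 2 R,
                C (x - y)) / ((R : ℕ) : ℝ) ^ 4) atTop))) := by
  intro ψ hnorm
  refine ⟨fun htight Ls C hLs hev hconv => stub_lroSeqTendstoAtom_of_tight ψ hnorm htight Ls C hLs
    hev hconv, fun hcons => ?_⟩
  by_contra hnt
  obtain ⟨η, hη, Ls, C, n₀, hLs, hev, hconv, hu, hgain⟩ := exists_massGain_of_not_tight ψ hnorm hnt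
  -- conservation identifies `n₀` with the atom of `C` ...
  have hlim := hcons Ls C hLs hev hconv
  have heq := tendsto_nhds_unique hu hlim
  -- ... but every block average of `C` exceeds `n₀` by `η`
  obtain ⟨B, hB⟩ : ∃ B : ℝ, B = (∑ e ∈ insert (0 : Site 2) unitSteps,
      ‖((dWaveFormFactor e / Real.sqrt 2 : ℝ) : ℂ)‖ * 2) ^ 2 := ⟨_, rfl⟩
  have hB0 : 0 ≤ B := by rw [hB]; positivity
  have hCbd : ∀ x, |C x| ≤ B := fun x =>
    hB ▸ abs_limit_corrAvg_le ψ Ls (fun j => hnorm _ (hev j)) C hconv x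
  have hb_up : ∀ R : ℕ, (∑ x ∈ halfOpenBox 2 R, ∑ y ∈ halfOpenBox 2 R, C (x - y)) /
      ((R : ℕ) : ℝ) ^ 4 ≤ B := fun R => (abs_le.1 (abs_boxAvg_le hB0 hCbd R)).2
  have hge : n₀ + η ≤ liminf (fun R : ℕ => (∑ x ∈ halfOpenBox 2 R, ∑ y ∈ halfOpenBox 2 R,
      C (x - y)) / ((R : ℕ) : ℝ) ^ 4) atTop :=
    le_liminf_of_le (isCoboundedUnder_ge_of_le atTop hb_up)
      ((eventually_gt_atTop 0).mono fun R hR => hgain R hR)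
  rw [← heq] at hge
  linarith

/-! ### The crux, reformulated in infinite volume -/

/-- **`NoInfraredPileUp` ⇔ CONSERVATION OF CONDENSATE MASS IN EVERY TORUS LIMIT.** The crux
stmt-HubbardSuperconductivity-18534 is equivalent to: for every hole doping `δ ∈ (0,1/2)` there is
`U₁ > 0` such that for every `U ∈ (0,U₁)` and every admissible ground-state family (`N_L = 2⌊(1−δ)L²/2⌋`,
`ψ_L` a normalised `(N_L, S^z = 0)`-sector ground state of the Hubbard torus at every even side),
along every strictly increasing sequence of even sides on which the translation-averaged `d`-wave pair
correlations converge pointwise, the torus condensate densities `|Λ_L|⁻² Σ_{x,y} G_L(x,y)` converge to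
the Bochner atom of the limit. Thus a refutation of the crux is precisely a weak-coupling ground-state
family with an infinite-volume limit carrying MORE `d_{x²−y²}` off-diagonal long-range order than the
limit of the torus order densities it comes from (generalised condensation feeding the atom), and a
proof is precisely the exclusion of such mass gain. (`stub_tight_iff_lroSeqTendstoAtom`, family by
family.) Kennedy–Lieb–Shastry, PRL 61 (1988) 2582; Girardeau, Phys. Fluids 5 (1962) 1468;
van den Berg–Lewis–Pulé, Helv. Phys. Acta 59 (1986) 1271. [folklore] -/
theorem noInfraredPileUp_iff_condensateMassConserved :
    Summit.HubbardSuperconductivity.HubbardSuperconductivity.Theses.InfiniteVolumeFirst.NoInfraredPileUp ↔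
      ∀ δ ∈ Set.Ioo (0:ℝ) (1 / 2), ∃ U₁ : ℝ, 0 < U₁ ∧ ∀ U ∈ Set.Ioo (0:ℝ) U₁,
        ∀ (N : ℕ → ℕ) (ψ : ∀ L, Fock (Orb (FermionTorus 2 L))),
          (∀ L, Even L → N L = 2 * ⌊(1 - δ) * (L : ℝ) ^ 2 / 2⌋₊ ∧ star (ψ L) ⬝ᵥ ψ L = 1 ∧
              IsGroundStateInSector (hubbardTorus 2 L 1 U) (N L) 0 (ψ L)) →
            ∀ (Ls : ℕ → ℕ) (C : Site 2 → ℝ), StrictMono Ls → (∀ j, Even (Ls j)) →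
              (∀ x : Site 2, Tendsto (fun j : ℕ => (∑ y ∈ halfOpenBox 2 (Ls j),
                  torusPullback (pairFieldCorr dWaveFormFactor ψ) (Ls j) (x + y) y) /
                    ((Ls j : ℕ) : ℝ) ^ 2) atTop (𝓝 (C x))) →
                Tendsto (fun j : ℕ => (∑ x ∈ halfOpenBox 2 (Ls j), ∑ y ∈ halfOpenBox 2 (Ls j),
                    torusPullback (pairFieldCorr dWaveFormFactor ψ) (Ls j) x y) /
                      ((halfOpenBox 2 (Ls j)).card : ℝ) ^ 2) atTop
                  (𝓝 (liminf (fun R : ℕ => (∑ x ∈ halfOpenBox 2 R, ∑ y ∈ halfOpenBox 2 R,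
                    C (x - y)) / ((R : ℕ) : ℝ) ^ 4) atTop)) := by
  constructor
  · intro h δ hδ
    obtain ⟨U₁, hU₁, h'⟩ := h δ hδ
    refine ⟨U₁, hU₁, fun U hU N ψ hadm => ?_⟩
    exact (stub_tight_iff_lroSeqTendstoAtom ψ (fun L hL => (hadm L hL).2.1)).1 (h' U hU N ψ hadm)
  · intro h δ hδ
    obtain ⟨U₁, hU₁, h'⟩ := h δ hδ
    refine ⟨U₁, hU₁, fun U hU N ψ hadm => ?_⟩
    exact (stub_tight_iff_lroSeqTendstoAtom ψ (fun L hL => (hadm L hL).2.1)).2 (h' U hU N ψ hadm)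

/-! ### The free endpoint -/

/-- **The crux's conclusion holds at the excluded endpoint `U = 0`, for EVERY free ground-state
family.** For any sector function `N` and any family `ψ_L` of normalised `(N_L, S^z = 0)`-sector ground
states of the FREE torus `hubbardTorus 2 L 1 0` at the even sides (the free sector ground spaces are
degenerate open shells and `ψ_L` is ANY unit vector in them — no Slater or density assumption), the
windows are tight: for `η > 0` take `ε := min 1 (η / 113)` and `L₀ := 3`, by the flat metallic law
`T_ε(ψ) ≤ 113 ε² L²` of `WindowInfraredBound.windowInfraredBound_free_allGroundStates`. So the
weak-coupling restriction `U ∈ (0, U₁)` of `NoInfraredPileUp` is not where a failure could come from at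
its lower end: any pile-up mechanism must be interaction-driven (and then, by
`noInfraredPileUp_iff_condensateMassConserved`, must feed an infinite-volume condensate).
Bardeen–Cooper–Schrieffer, Phys. Rev. 108 (1957) 1175, §II; Yang, Rev. Mod. Phys. 34 (1962) 694, §3.
[folklore] -/
theorem noInfraredPileUp_conclusion_at_zero_coupling (N : ℕ → ℕ)
    (ψ : ∀ L, Fock (Orb (FermionTorus 2 L)))
    (hadm : ∀ L, Even L → star (ψ L) ⬝ᵥ ψ L = 1 ∧
      IsGroundStateInSector (hubbardTorus 2 L 1 0) (N L) 0 (ψ L)) :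
    ∀ η : ℝ, 0 < η → ∃ ε : ℝ, 0 < ε ∧ ∃ L₀ : ℕ, ∀ (L : ℕ) [NeZero L], Even L → L₀ ≤ L →
      (∑ m : Fin 2 → ZMod L, if m ≠ 0 ∧ momentumNormSq L m ≤ ε ^ 2 then
          pairStructureFactor dWaveFormFactor L (ψ L) m else 0) ≤ η * (L : ℝ) ^ 2 := by
  intro η hη
  have hεpos : 0 < min 1 (η / 113) := lt_min one_pos (by positivity)
  refine ⟨min 1 (η / 113), hεpos, 3, fun L _ hL hLL => ?_⟩
  have h := WindowInfraredBound.windowInfraredBound_free_allGroundStates hLL (hadm L hL).2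
    (hadm L hL).1 hεpos
  refine h.trans (mul_le_mul_of_nonneg_right ?_ (sq_nonneg _))
  have h1 : min 1 (η / 113) ≤ 1 := min_le_left _ _
  have h2 : min 1 (η / 113) ≤ η / 113 := min_le_right _ _
  have hsq : (min 1 (η / 113)) ^ 2 ≤ min 1 (η / 113) := by
    rw [sq]; exact mul_le_of_le_one_left hεpos.le h1
  linarith

/-! ### The exact decomposition at fixed coupling -/

/-- **EXACT DECOMPOSITION OF THE SUMMIT'S CONCLUSION AT FIXED `(U, δ)`.** Every admissible
ground-state family (`N_L = 2⌊(1−δ)L²/2⌋`, `ψ_L` a normalised `(N_L, S^z=0)`-sector ground state of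
`hubbardTorus 2 L 1 U` at every even side) has `d`-wave pair-field LRO along the even sides IFF
(a) every pointwise torus-limit of every admissible family has a positive atom (`NoNormalLimitState` at
`(U, δ)`) AND (b) every admissible family satisfies Sub₁ (⇒: `atom_pos_of_hasLongRangeOrder` and
`noSliding_of_hasLongRangeOrder`; ⇐: `noSliding_iff_hasLongRangeOrder_of_atomPos`): with Sub₁ in
place of `NoInfraredPileUp` the route is a lossless decomposition of the summit, coupling by coupling.
Koma–Tasaki, J. Stat. Phys. 76 (1994) 745; Kennedy–Lieb–Shastry, PRL 61 (1988) 2582. [folklore] -/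
theorem summitAt_iff_atomPos_and_noSliding (U δ : ℝ) :
    (∀ (N : ℕ → ℕ) (ψ : ∀ L, Fock (Orb (FermionTorus 2 L))),
        (∀ L, Even L → N L = 2 * ⌊(1 - δ) * (L : ℝ) ^ 2 / 2⌋₊ ∧ star (ψ L) ⬝ᵥ ψ L = 1 ∧
            IsGroundStateInSector (hubbardTorus 2 L 1 U) (N L) 0 (ψ L)) →
          HasLongRangeOrder (fun k => halfOpenBox 2 (2 * k))
            (fun k => torusPullback (pairFieldCorr dWaveFormFactor ψ) (2 * k))) ↔
      (∀ (N : ℕ → ℕ) (ψ : ∀ L, Fock (Orb (FermionTorus 2 L))),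
          (∀ L, Even L → N L = 2 * ⌊(1 - δ) * (L : ℝ) ^ 2 / 2⌋₊ ∧ star (ψ L) ⬝ᵥ ψ L = 1 ∧
              IsGroundStateInSector (hubbardTorus 2 L 1 U) (N L) 0 (ψ L)) →
            ∀ (Ls : ℕ → ℕ) (C : Site 2 → ℝ), StrictMono Ls → (∀ j, Even (Ls j)) →
              (∀ x : Site 2, Tendsto (fun j : ℕ => (∑ y ∈ halfOpenBox 2 (Ls j),
                  torusPullback (pairFieldCorr dWaveFormFactor ψ) (Ls j) (x + y) y) /
                    ((Ls j : ℕ) : ℝ) ^ 2) atTop (𝓝 (C x))) →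
                0 < liminf (fun R : ℕ => (∑ x ∈ halfOpenBox 2 R, ∑ y ∈ halfOpenBox 2 R,
                  C (x - y)) / ((R : ℕ) : ℝ) ^ 4) atTop) ∧
        ∀ (N : ℕ → ℕ) (ψ : ∀ L, Fock (Orb (FermionTorus 2 L))),
          (∀ L, Even L → N L = 2 * ⌊(1 - δ) * (L : ℝ) ^ 2 / 2⌋₊ ∧ star (ψ L) ⬝ᵥ ψ L = 1 ∧
              IsGroundStateInSector (hubbardTorus 2 L 1 U) (N L) 0 (ψ L)) →
            ∀ η : ℝ, 0 < η → ∃ θ : ℝ, 0 < θ ∧ ∃ ε : ℝ, 0 < ε ∧ ∃ L₀ : ℕ, ∀ (L : ℕ) [NeZero L],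
              Even L → L₀ ≤ L →
                pairStructureFactor dWaveFormFactor L (ψ L) 0 ≤ θ * (L : ℝ) ^ 2 →
                  (∑ m : Fin 2 → ZMod L, if m ≠ 0 ∧ momentumNormSq L m ≤ ε ^ 2 then
                      pairStructureFactor dWaveFormFactor L (ψ L) m else 0) ≤ η * (L : ℝ) ^ 2 := by
  refine ⟨fun h => ⟨fun N ψ hadm Ls C hLs hev hconv => ?_, fun N ψ hadm =>
    noSliding_of_hasLongRangeOrder ψ (h N ψ hadm)⟩, fun h N ψ hadm => ?_⟩
  · exact NoNormalLimitState.atom_pos_of_hasLongRangeOrder ψ (fun L hL => (hadm L hL).2.1)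
      (h N ψ hadm) Ls C hLs hev hconv
  · exact (noSliding_iff_hasLongRangeOrder_of_atomPos ψ (fun L hL => (hadm L hL).2.1)
      (h.1 N ψ hadm)).1 (h.2 N ψ hadm)

end Summit.HubbardSuperconductivity.HubbardSuperconductivity.Theorems.NoInfraredPileUp

end
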